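import Literature.Computability.AlgebraicComplexity.MS21ReadOnceOrbitHittingProofs
import HarnessLib

/-!
# Medini–Shpilka 2021, Lemma 6.2 and Cor 6.3: independent maps hit the directional derivatives of
# the affine orbit of the diagonal tensor `T_{s,d}` (engine for Thm 45)

Theorem-only support file for `MS21DenseOrbitsHittingSets.lean` (cell `val-lit`, seat t18 g5; the
§6.2 ENGINE for the `MS2021_thm_45` discharge of seat x6 g3). It PROVES, following the printed proof
[MediniShpilka2021, §6.2, Lemma 6.2 and Cor 6.3, arXiv:2102.05632 p0035:L15–L56]:

> **Lemma 6.2.** Let `f ∈ T^{GLaff_n(F)}`, `k ∈ ℕ` and `v_1, …, v_k ∈ F^n`. Then, for any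
> `(k+2)`-independent map `G`: `∂^k f/∂v_1⋯∂v_k ≠ 0 ⇒ (∂^k f/∂v_1⋯∂v_k) ∘ G ≠ 0`.
>
> **Corollary 6.3.** If `0 ≠ f ∈ T^{GLaff_n(F)}`, then for any `2`-independent map `G`: `f ∘ G ≠ 0`.

(`T_{s,d} = Σ_{i ≤ s} ∏_{j ≤ d} x_{i,j}` is the tree's `MS2021.sdm K s d`; `T^{GLaff_n}` its affine orbit
`MS2021.affOrbit n (sdm K s d)`; `k`-independent maps are `MS2021.IsIndependent`; the directional
derivative `∂f/∂v = Σ_i v_i ∂f/∂x_i` of Def 3.6 is written `∑ j, C (v j) * pderiv j f` and the iterate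
`∂^k f/∂v_1⋯∂v_k` as `(List.ofFn v).foldr (fun w p => ∑ j, C (w j) * pderiv j p) f`, the conventions of
the §3 toolkit `MS21IndependentMapLemmas.lean`, seat t24 g5.) The statements are proved for every
`B`-independent map with `k + 2 ≤ B` (extra blocks are carried along in the "`H`" of Lemmas 3.9/3.10),
so that Thm 45's uniform `6`-independent map can be fed in directly.

Printed proof, as formalised ("upstairs", on `T_{s,d}` itself — `f = T_{s,d}(Ax + b)` and, by the
chain rule, `∂^k f/∂v_1⋯∂v_k = (∂^k T_{s,d}/∂u_1⋯∂u_k)(Ax + b)` with `u_r = A v_r`):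
* "`Q_i(ℓ_{i,1}, …, ℓ_{i,d}) = Σ_{|S| = k} α_S ∏_{j ∉ S} ℓ_{i,j}`": every monomial of
  `P := ∂^k T_{s,d}/∂u_1⋯∂u_k` is a sub-product `∏_{j ∈ J} x_{i,j}` of ONE block with `|J| = d - k`
  (`MS2021.DiagDeriv.blockSupport_*`);
* "Fix some `i` such that `Q_i` is non-constant … consider the derivative in direction `u_{i,1}`":
  a non-constant such `P` has `∂P/∂x_{i,j₁} ≠ 0` for a variable of one of its monomials; by Lemma 3.8
  (toolkit `sum_C_mul_pderiv_affSubst`) `∂f/∂v = (∂P/∂x_{i,j₁})(Ax + b)` for the dual `v`, and by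
  Lemma 3.9 (toolkit `bind₁_peel_ne_zero_of_dirDeriv`) it suffices that the remaining `k+1` blocks
  hit `(∂P/∂x_{i,j₁})(Ax + b)`;
* "Assume `α_T ≠ 0` … every other term is divisible by one of the `ℓ_{i,j}`, `j ∈ T` … restrict to
  `V = {ℓ_{i,j} = 0, j ∈ T}` … (lem:indProjectZero)": `k` shifts (toolkit `exists_shift_affSubst_eq` +
  `bind₁_peel_ne_zero_of_shift`, once per element of `T`) turn `(∂P/∂x_{i,j₁})(Ax + b)` into
  `α_T · ∏_{j ∉ T ∪ {j₁}} (ℓ̃_{i,j}(x) + b̃_{i,j})` with `ℓ̃` the rows of an invertible matrix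
  (`MS2021.DiagDeriv.shift_induction`);
* "As the right term is a product of linear functions, we get from (obs:kwise) that … `∘ G_1^{(2)} ≠ 0`":
  toolkit `IsIndependent.bind₁_affine_ne_zero`, factor by factor.

No new definitions, no new facts (D-0026): net debt `0` (support file). HONEST FRAMING: a known 2021
lemma is now a theorem of the tree; `VP ≠ VNP` is NOT proved and this is no progress on it.

## References
* [MediniShpilka2021] D. Medini, A. Shpilka, CCC 2021 (LIPIcs 200:19) §6.2: Lemma 6.2, Cor 6.3 and
  their proofs (arXiv:2102.05632 held text p0035:L15–L56); Def 40 (`T_{s,d}`), Def 19, §3 (Lemmas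
  3.8–3.10).
-/

noncomputable section

open MvPolynomial Matrix

namespace Literature.Computability.AlgebraicComplexity

namespace MS2021

namespace DiagDeriv

/-! ### Block sub-products: the monomials `∏_{j ∈ J} x_{i,j}` and their exponent vectors -/

section Blocks

variable {K : Type*} [Field K] {s d : ℕ}

/-- The exponent vector `𝟙_{(i,J)} = Σ_{j ∈ J} e_{(i,j)}` of the block sub-product `∏_{j ∈ J} x_{i,j}`
evaluates to `1` on the variables `x_{i,j}`, `j ∈ J`, and to `0` elsewhere.
[cite: MediniShpilka2021, Def 40 and proof of Lemma 6.2 ("`∏_{j ∈ [d] ∖ S} ℓ_{i,j}`"; arXiv p0008:L51-L53, p0035:L32-L34)] -/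
theorem blockInd_apply (i : Fin s) (J : Finset (Fin d)) (i' : Fin s) (j' : Fin d) :
    (∑ j ∈ J, Finsupp.single (finProdFinEquiv (i, j)) (1 : ℕ)) (finProdFinEquiv (i', j')) =
      if i' = i ∧ j' ∈ J then 1 else 0 := by
  classical
  simp only [Finsupp.coe_finsetSum, Finset.sum_apply, Finsupp.single_apply,
    EmbeddingLike.apply_eq_iff_eq, Prod.mk.injEq]
  by_cases hi : i' = i
  · subst hi
    simp only [true_and]
    rw [Finset.sum_ite_eq' J j' (fun _ => (1 : ℕ))]
  · rw [if_neg fun h => hi h.1]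
    exact Finset.sum_eq_zero fun j _ => if_neg fun h => hi h.1.symm

/-- Every variable is `x_{i',j'}` for a unique pair. [folklore] -/
private theorem exists_eq_finProdFinEquiv (w : Fin (s * d)) : ∃ i' j', w = finProdFinEquiv (i', j') :=
  ⟨(finProdFinEquiv.symm w).1, (finProdFinEquiv.symm w).2,
    (finProdFinEquiv.apply_symm_apply w).symm⟩

/-- `𝟙_{(i,J)}` takes only the values `0` and `1` (block sub-products are multilinear), with value `1`
exactly on `{x_{i,j} : j ∈ J}`. [cite: MediniShpilka2021, Def 40 ("a sum of `s` variable disjoint monomials", multilinear; arXiv p0008:L51-L53)] -/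
theorem blockInd_apply_eq_one_iff (i : Fin s) (J : Finset (Fin d)) (w : Fin (s * d)) :
    (∑ j ∈ J, Finsupp.single (finProdFinEquiv (i, j)) (1 : ℕ)) w = 1 ↔
      ∃ j ∈ J, w = finProdFinEquiv (i, j) := by
  obtain ⟨i', j', rfl⟩ := exists_eq_finProdFinEquiv w
  rw [blockInd_apply]
  constructor
  · intro h
    by_cases hc : i' = i ∧ j' ∈ J
    · exact ⟨j', hc.2, by rw [hc.1]⟩
    · rw [if_neg hc] at h
      exact absurd h zero_ne_one
  · rintro ⟨j, hj, hw⟩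
    have hw' := finProdFinEquiv.injective hw
    rw [Prod.mk.injEq] at hw'
    rw [if_pos ⟨hw'.1, hw'.2 ▸ hj⟩]

/-- Block sub-products are multilinear: every exponent of `𝟙_{(i,J)}` is `≤ 1`.
[cite: MediniShpilka2021, Def 40 ("a sum of `s` variable disjoint monomials"; arXiv p0008:L51-L53)] -/
theorem blockInd_apply_le_one (i : Fin s) (J : Finset (Fin d)) (w : Fin (s * d)) :
    (∑ j ∈ J, Finsupp.single (finProdFinEquiv (i, j)) (1 : ℕ)) w ≤ 1 := by
  obtain ⟨i', j', rfl⟩ := exists_eq_finProdFinEquiv w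
  rw [blockInd_apply]
  split_ifs <;> simp

/-- Removing the variable `x_{i,j₀}`, `j₀ ∈ J`, from `𝟙_{(i,J)}` gives `𝟙_{(i, J ∖ {j₀})}`:
`𝟙_{(i, J.erase j₀)} + e_{(i,j₀)} = 𝟙_{(i,J)}` (the exponent arithmetic of `∂/∂x_{i,j₀} ∏_{j ∈ J} x_{i,j}`).
[cite: MediniShpilka2021, proof of Lemma 6.2 ("`Q_i … = Σ_{|S|=k} α_S ∏_{j ∈ [d]∖S} ℓ_{i,j}`"; arXiv p0035:L32-L34)] -/
theorem blockInd_erase_add_single (i : Fin s) {J : Finset (Fin d)} {j₀ : Fin d} (hj₀ : j₀ ∈ J) :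
    (∑ j ∈ J.erase j₀, Finsupp.single (finProdFinEquiv (i, j)) (1 : ℕ)) +
        Finsupp.single (finProdFinEquiv (i, j₀)) 1 =
      ∑ j ∈ J, Finsupp.single (finProdFinEquiv (i, j)) (1 : ℕ) := by
  rw [← Finset.sum_erase_add J _ hj₀]

/-- Conversely: if `m + e_w = 𝟙_{(i,J)}` then `w = x_{i,j₀}` for some `j₀ ∈ J` and `m = 𝟙_{(i, J ∖ {j₀})}`.
[cite: MediniShpilka2021, proof of Lemma 6.2 (arXiv p0035:L32-L34)] -/
theorem exists_of_add_single_eq_blockInd (i : Fin s) (J : Finset (Fin d)) (m : Fin (s * d) →₀ ℕ)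
    (w : Fin (s * d))
    (h : m + Finsupp.single w 1 = ∑ j ∈ J, Finsupp.single (finProdFinEquiv (i, j)) (1 : ℕ)) :
    ∃ j₀ ∈ J, w = finProdFinEquiv (i, j₀) ∧
      m = ∑ j ∈ J.erase j₀, Finsupp.single (finProdFinEquiv (i, j)) (1 : ℕ) := by
  classical
  have hw1 : (∑ j ∈ J, Finsupp.single (finProdFinEquiv (i, j)) (1 : ℕ)) w = 1 := by
    have hle := blockInd_apply_le_one i J w
    have hge : 1 ≤ (∑ j ∈ J, Finsupp.single (finProdFinEquiv (i, j)) (1 : ℕ)) w := by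
      rw [← h, Finsupp.add_apply, Finsupp.single_eq_same]
      exact Nat.le_add_left 1 _
    omega
  obtain ⟨j₀, hj₀, rfl⟩ := (blockInd_apply_eq_one_iff i J w).mp hw1
  refine ⟨j₀, hj₀, rfl, ?_⟩
  have key := blockInd_erase_add_single i hj₀ (s := s)
  rw [← h] at key
  exact (add_right_cancel key).symm

/-- **The block sub-product as a monomial**: `∏_{j ∈ J} x_{i,j} = x^{𝟙_{(i,J)}}`.
[cite: MediniShpilka2021, Def 40 (arXiv p0008:L51-L53)] -/
theorem prod_X_eq_monomial (i : Fin s) (J : Finset (Fin d)) :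
    (∏ j ∈ J, X (finProdFinEquiv (i, j)) : MvPolynomial (Fin (s * d)) K) =
      monomial (∑ j ∈ J, Finsupp.single (finProdFinEquiv (i, j)) (1 : ℕ)) 1 := by
  classical
  induction J using Finset.induction_on with
  | empty => simp
  | insert j J hj ih =>
      rw [Finset.prod_insert hj, Finset.sum_insert hj, ih, X, monomial_mul, one_mul]

/-- **`T_{s,d}` as a sum of block monomials**: `T_{s,d} = Σ_i x^{𝟙_{(i,[d])}}`.
[cite: MediniShpilka2021, Def 40 (arXiv p0008:L51-L53)] -/
theorem sdm_eq_sum_monomial (K : Type*) [Field K] (s d : ℕ) :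
    sdm K s d = ∑ i : Fin s, monomial (∑ j ∈ (Finset.univ : Finset (Fin d)),
      Finsupp.single (finProdFinEquiv (i, j)) (1 : ℕ)) (1 : K) := by
  unfold sdm
  exact Finset.sum_congr rfl fun i _ => prod_X_eq_monomial i _

end Blocks

/-! ### The support invariant: every monomial is a co-size-`k` sub-product of one block -/

section Invariant

variable {K : Type*} [Field K] {s d : ℕ}

/-- `T_{s,d}` itself: every monomial is a full block (`k = 0`).
[cite: MediniShpilka2021, Def 40 (arXiv p0008:L51-L53)] -/
theorem blockSupport_sdm :
    ∀ m ∈ (sdm K s d).support, ∃ (i : Fin s) (J : Finset (Fin d)), J.card + 0 = d ∧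
      m = ∑ j ∈ J, Finsupp.single (finProdFinEquiv (i, j)) (1 : ℕ) := by
  classical
  intro m hm
  rw [sdm_eq_sum_monomial] at hm
  obtain ⟨i, -, hi⟩ := Finset.mem_biUnion.mp (support_sum hm)
  rw [support_monomial, if_neg one_ne_zero, Finset.mem_singleton] at hi
  exact ⟨i, Finset.univ, by simp, hi⟩

/-- **`∂/∂x_w` raises the co-size by one**: if every monomial of `P` is a block sub-product
`∏_{j ∈ J} x_{i,j}` with `|J| = d - k`, then every monomial of `∂P/∂x_w` is one with `|J| = d - (k+1)`
— and, recording more, it arises by erasing `w = x_{i,j₀}` from a monomial of `P`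
("`∂^k(∏_j ℓ_{i,j})/∂v_1⋯∂v_k = Σ_{|S| = k} α_S ∏_{j ∉ S} ℓ_{i,j}`").
[cite: MediniShpilka2021, proof of Lemma 6.2 (arXiv p0035:L32-L34)] -/
theorem blockSupport_pderiv {k : ℕ} {P : MvPolynomial (Fin (s * d)) K}
    (hP : ∀ m ∈ P.support, ∃ (i : Fin s) (J : Finset (Fin d)), J.card + k = d ∧
      m = ∑ j ∈ J, Finsupp.single (finProdFinEquiv (i, j)) (1 : ℕ))
    (w : Fin (s * d)) :
    ∀ m ∈ (pderiv w P).support, ∃ (i : Fin s) (J : Finset (Fin d)) (j₀ : Fin d),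
      j₀ ∉ J ∧ w = finProdFinEquiv (i, j₀) ∧ J.card + (k + 1) = d ∧
      (∑ j ∈ insert j₀ J, Finsupp.single (finProdFinEquiv (i, j)) (1 : ℕ)) ∈ P.support ∧
      m = ∑ j ∈ J, Finsupp.single (finProdFinEquiv (i, j)) (1 : ℕ) := by
  classical
  intro m hm
  rw [mem_support_iff, coeff_pderiv] at hm
  have hm' : coeff (m + Finsupp.single w 1) P ≠ 0 := fun h0 => hm (by rw [h0, zero_mul])
  obtain ⟨i, J, hJ, hmJ⟩ := hP _ (mem_support_iff.mpr hm')
  obtain ⟨j₀, hj₀, hw, hmeq⟩ := exists_of_add_single_eq_blockInd i J m w hmJ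
  refine ⟨i, J.erase j₀, j₀, Finset.notMem_erase j₀ J, hw, ?_, ?_, hmeq⟩
  · rw [Finset.card_erase_of_mem hj₀]
    have := Finset.card_pos.mpr ⟨j₀, hj₀⟩
    omega
  · rw [Finset.insert_erase hj₀, ← hmJ]
    exact mem_support_iff.mpr hm'

/-- The invariant without the extra bookkeeping. [cite: MediniShpilka2021, proof of Lemma 6.2 (arXiv p0035:L32-L34)] -/
theorem blockSupport_pderiv' {k : ℕ} {P : MvPolynomial (Fin (s * d)) K}
    (hP : ∀ m ∈ P.support, ∃ (i : Fin s) (J : Finset (Fin d)), J.card + k = d ∧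
      m = ∑ j ∈ J, Finsupp.single (finProdFinEquiv (i, j)) (1 : ℕ))
    (w : Fin (s * d)) :
    ∀ m ∈ (pderiv w P).support, ∃ (i : Fin s) (J : Finset (Fin d)), J.card + (k + 1) = d ∧
      m = ∑ j ∈ J, Finsupp.single (finProdFinEquiv (i, j)) (1 : ℕ) := by
  intro m hm
  obtain ⟨i, J, j₀, -, -, hJ, -, hmeq⟩ := blockSupport_pderiv hP w m hm
  exact ⟨i, J, hJ, hmeq⟩

/-- **The directional derivative `D_u = Σ_w u_w ∂/∂x_w` raises the co-size by one.**
[cite: MediniShpilka2021, Def 3.6 and proof of Lemma 6.2 (arXiv p0017:L46, p0035:L32-L34)] -/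
theorem blockSupport_dirDeriv {k : ℕ} {P : MvPolynomial (Fin (s * d)) K}
    (hP : ∀ m ∈ P.support, ∃ (i : Fin s) (J : Finset (Fin d)), J.card + k = d ∧
      m = ∑ j ∈ J, Finsupp.single (finProdFinEquiv (i, j)) (1 : ℕ))
    (u : Fin (s * d) → K) :
    ∀ m ∈ (∑ w, C (u w) * pderiv w P).support, ∃ (i : Fin s) (J : Finset (Fin d)),
      J.card + (k + 1) = d ∧ m = ∑ j ∈ J, Finsupp.single (finProdFinEquiv (i, j)) (1 : ℕ) := by
  classical
  intro m hm
  obtain ⟨w, -, hw⟩ := Finset.mem_biUnion.mp (support_sum hm)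
  rw [C_mul'] at hw
  exact blockSupport_pderiv' hP w m (support_smul hw)

/-- **Iterated**: every monomial of `∂^k T_{s,d}/∂u_1⋯∂u_k` is a block sub-product of co-size `k`
("`g = Σ_i Q_i(ℓ_{i,1}, …, ℓ_{i,d})`, `Q_i = Σ_{|S|=k} α_S ∏_{j ∉ S} w_j`").
[cite: MediniShpilka2021, proof of Lemma 6.2 (arXiv p0035:L24-L34)] -/
theorem blockSupport_iterate_dirDeriv_sdm (k : ℕ) (u : Fin k → Fin (s * d) → K) :
    ∀ m ∈ ((List.ofFn u).foldr (fun w p => ∑ x, C (w x) * pderiv x p) (sdm K s d)).support,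
      ∃ (i : Fin s) (J : Finset (Fin d)), J.card + k = d ∧
        m = ∑ j ∈ J, Finsupp.single (finProdFinEquiv (i, j)) (1 : ℕ) := by
  induction k with
  | zero =>
      rw [List.ofFn_zero, List.foldr_nil]
      exact blockSupport_sdm
  | succ k ih =>
      rw [List.ofFn_succ, List.foldr_cons]
      have := blockSupport_dirDeriv (ih (fun l => u l.succ)) (u 0)
      simpa only [Nat.add_comm k 1, ← Nat.add_assoc] using this

end Invariant

/-! ### Killing the variables `x_{i,j}`, `j ∈ U` ("restrict to `V = {ℓ_{i,j} = 0, j ∈ T}`") -/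

section Kill

variable {K : Type*} [Field K] {s d : ℕ}

/-- One more killed variable: `σ_Z ∘ σ_{x_r} = σ_{Z ∪ {x_r}}` for the substitutions setting a set of
variables to `0` (the iteration "apply the result iteratively" of Lemma 3.10).
[cite: MediniShpilka2021, Lemma 3.10 and proof of Lemma 6.2 (arXiv p0018:L19-L20, p0035:L44-L46)] -/
theorem aeval_kill_aeval_kill_single (Z : Finset (Fin (s * d))) (r : Fin (s * d))
    (Q : MvPolynomial (Fin (s * d)) K) :
    aeval (fun w => if w ∈ Z then (0 : MvPolynomial (Fin (s * d)) K) else X w)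
        (aeval (fun w => if w = r then (0 : MvPolynomial (Fin (s * d)) K) else X w) Q) =
      aeval (fun w => if w ∈ insert r Z then (0 : MvPolynomial (Fin (s * d)) K) else X w) Q := by
  classical
  rw [← AlgHom.comp_apply, comp_aeval]
  have hfun : (fun w => aeval (fun w => if w ∈ Z then (0 : MvPolynomial (Fin (s * d)) K) else X w)
      (if w = r then (0 : MvPolynomial (Fin (s * d)) K) else X w)) =
      fun w => if w ∈ insert r Z then (0 : MvPolynomial (Fin (s * d)) K) else X w := by
    funext w
    by_cases hw : w = r
    · subst hw
      simp
    · rw [if_neg hw, aeval_X]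
      have hiff : w ∈ insert r Z ↔ w ∈ Z := by
        rw [Finset.mem_insert]
        simp only [hw, false_or]
      by_cases hwZ : w ∈ Z
      · rw [if_pos hwZ, if_pos (hiff.mpr hwZ)]
      · rw [if_neg hwZ, if_neg (fun h' => hwZ (hiff.mp h'))]
  rw [hfun]

/-- Killing no variable is the identity. [folklore] -/
private theorem aeval_kill_empty (Q : MvPolynomial (Fin (s * d)) K) :
    aeval (fun w => if w ∈ (∅ : Finset (Fin (s * d))) then (0 : MvPolynomial (Fin (s * d)) K) else X w)
      Q = Q := by
  have hX : (fun w => if w ∈ (∅ : Finset (Fin (s * d))) then (0 : MvPolynomial (Fin (s * d)) K)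
      else X w) = X := by
    funext w
    rw [if_neg (Finset.notMem_empty w)]
  rw [hX, aeval_X_left, AlgHom.id_apply]

/-- **Killing `{x_{i,j} : j ∈ U}` on a block monomial of the same block**: `∏_{j ∈ J} x_{i,j}` survives
(unchanged) iff `J ∩ U = ∅`, and dies otherwise ("every other term is divisible by one of the
functions `ℓ_{i,j}`, for `j ∈ T`"). [cite: MediniShpilka2021, proof of Lemma 6.2 (arXiv p0035:L40-L42)] -/
theorem aeval_kill_monomial_blockInd (i : Fin s) (U J : Finset (Fin d)) (c : K) :
    aeval (fun w => if w ∈ U.image (fun j => finProdFinEquiv (i, j))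
        then (0 : MvPolynomial (Fin (s * d)) K) else X w)
      (monomial (∑ j ∈ J, Finsupp.single (finProdFinEquiv (i, j)) (1 : ℕ)) c) =
      if Disjoint J U then monomial (∑ j ∈ J, Finsupp.single (finProdFinEquiv (i, j)) (1 : ℕ)) c
      else 0 := by
  classical
  have hmon : (monomial (∑ j ∈ J, Finsupp.single (finProdFinEquiv (i, j)) (1 : ℕ)) c :
      MvPolynomial (Fin (s * d)) K) = C c * ∏ j ∈ J, X (finProdFinEquiv (i, j)) := by
    rw [prod_X_eq_monomial, C_mul_monomial, mul_one]
  rw [hmon, map_mul, aeval_C, algebraMap_eq, map_prod]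
  have hfac : ∀ j : Fin d, aeval (fun w => if w ∈ U.image (fun j => finProdFinEquiv (i, j))
      then (0 : MvPolynomial (Fin (s * d)) K) else X w)
      (X (finProdFinEquiv (i, j)) : MvPolynomial (Fin (s * d)) K) =
      if j ∈ U then (0 : MvPolynomial (Fin (s * d)) K) else X (finProdFinEquiv (i, j)) := by
    intro j
    rw [aeval_X]
    have hiff : finProdFinEquiv (i, j) ∈ U.image (fun j => finProdFinEquiv (i, j)) ↔ j ∈ U := by
      simp [Finset.mem_image]
    by_cases hj : j ∈ U
    · rw [if_pos (hiff.mpr hj), if_pos hj]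
    · rw [if_neg (fun h' => hj (hiff.mp h')), if_neg hj]
  simp_rw [hfac]
  split_ifs with hJU
  · congr 1
    exact Finset.prod_congr rfl fun j hj => if_neg fun hjU => Finset.disjoint_left.mp hJU hj hjU
  · obtain ⟨j, hjJ, hjU⟩ := Finset.not_disjoint_iff.mp hJU
    rw [Finset.prod_eq_zero hjJ (by rw [if_pos hjU]), mul_zero]

end Kill

/-! ### The shift induction (Lemma 3.10 once per killed variable) and the restriction step -/

section Shift

variable {K : Type*} [Field K] {s d n : ℕ}

/-- **Iterated Lemma 3.10 for block variables.** To show that `Q(Ax + b) ∘ G ≠ 0` for every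
invertible affine `(A, b)` and every `B`-independent `G` with `B ≥ |U| + 1`, it suffices that
`Q|_{x_{i,j} = 0, j ∈ U}(A'x + b') ∘ H ≠ 0` for every invertible affine `(A', b')` and every
`B'`-independent `H`, `B' ≥ 1`: peel one block of `G` per `j ∈ U` and shift along it
("(lem:indProjectZero) implies that there exist linear functions `L_1, …, L_k` and an assignment `β`
such that … `∂g/∂u_{i,1}(x + G_k(β, L(x))) = α_T ∏ … ≠ 0`").
[cite: MediniShpilka2021, Lemma 3.10 and proof of Lemma 6.2 (arXiv p0018:L17-L40, p0035:L44-L48)] -/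
theorem shift_induction (h : s * d ≤ n) (i : Fin s) (U : Finset (Fin d)) :
    ∀ (Q : MvPolynomial (Fin (s * d)) K),
      (∀ (A : Matrix (Fin n) (Fin n) K) (b : Fin n → K), IsUnit A.det →
        ∀ (B c : ℕ) (H : Fin n → MvPolynomial (Fin B × (Fin c ⊕ Unit)) K), IsIndependent B H →
          1 ≤ B →
          bind₁ H (affSubst h A b (aeval (fun w => if w ∈ U.image (fun j => finProdFinEquiv (i, j))
            then (0 : MvPolynomial (Fin (s * d)) K) else X w) Q)) ≠ 0) →
      ∀ (A : Matrix (Fin n) (Fin n) K) (b : Fin n → K), IsUnit A.det →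
        ∀ (B c : ℕ) (G : Fin n → MvPolynomial (Fin B × (Fin c ⊕ Unit)) K), IsIndependent B G →
          U.card + 1 ≤ B → bind₁ G (affSubst h A b Q) ≠ 0 := by
  classical
  induction U using Finset.induction_on with
  | empty =>
      intro Q hQ A b hA B c G hG hB
      have := hQ A b hA B c G hG (by simpa using hB)
      rwa [Finset.image_empty, aeval_kill_empty] at this
  | insert r U hr ih =>
      intro Q hQ A b hA B c G hG hB
      rw [Finset.card_insert_of_notMem hr] at hB
      obtain ⟨B', rfl⟩ : ∃ B', B = B' + 1 := ⟨B - 1, by omega⟩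
      obtain ⟨G₁, G', hG₁, hG', hGeq⟩ := isIndependent_succ_iff.mp hG
      -- one shift, killing `x_{i,r}` (Lemma 3.10)
      obtain ⟨i₀, L, A', b', -, hA', heq⟩ :=
        exists_shift_affSubst_eq h hA b Q (finProdFinEquiv (i, r))
      -- the remaining kills, by induction, for the projected polynomial
      have hQ₁ := ih (aeval (fun w => if w = finProdFinEquiv (i, r)
          then (0 : MvPolynomial (Fin (s * d)) K) else X w) Q) (fun A'' b'' hA'' B'' c'' H hH hB'' => by
        have himg : insert (finProdFinEquiv (i, r)) (U.image fun j => finProdFinEquiv (i, j)) =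
            (insert r U).image fun j => finProdFinEquiv (i, j) := by
          rw [Finset.image_insert]
        rw [aeval_kill_aeval_kill_single, himg]
        exact hQ A'' b'' hA'' B'' c'' H hH hB'') A' b' hA' B' c G' hG' (by omega)
      rw [← heq] at hQ₁
      have hGfun : G = fun j => rename (Prod.mk 0) (G₁ j) + rename (Prod.map Fin.succ id) (G' j) :=
        funext hGeq
      rw [hGfun]
      exact bind₁_peel_ne_zero_of_shift hG₁ G' (affSubst h A b Q) i₀ L hQ₁

/-- `(C c ∏_{j ∈ J} (row_{i,j} affine form)) ∘ H ≠ 0` for `c ≠ 0`, invertible `A` and a `B`-independent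
`H`, `B ≥ 1`: "As the right term is a product of linear functions, we get from
(obs:kwise)((item:coordsGenInd)) that … `∘ G_1^{(2)} ≠ 0`".
[cite: MediniShpilka2021, proof of Lemma 6.2 (arXiv p0035:L48-L50); Obs 3.1 (2)] -/
theorem bind₁_affSubst_monomial_blockInd_ne_zero (h : s * d ≤ n) (i : Fin s) (J : Finset (Fin d))
    {c₀ : K} (hc₀ : c₀ ≠ 0) {A : Matrix (Fin n) (Fin n) K} (hA : IsUnit A.det) (b : Fin n → K)
    {B c : ℕ} (H : Fin n → MvPolynomial (Fin B × (Fin c ⊕ Unit)) K) (hH : IsIndependent B H)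
    (hB : 1 ≤ B) :
    bind₁ H (affSubst h A b
      (monomial (∑ j ∈ J, Finsupp.single (finProdFinEquiv (i, j)) (1 : ℕ)) c₀)) ≠ 0 := by
  classical
  rw [← mul_one c₀, ← C_mul_monomial, ← prod_X_eq_monomial]
  unfold affSubst
  rw [map_mul, map_prod, aeval_C, algebraMap_eq, map_mul, bind₁_C_right, map_prod]
  refine mul_ne_zero (by rwa [Ne, C_eq_zero]) (Finset.prod_ne_zero_iff.mpr fun j _ => ?_)
  rw [aeval_X]
  exact hH.bind₁_affine_ne_zero hB _ _ (exists_apply_ne_zero_of_isUnit_det hA _)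

/-- **The restriction step.** If `P' ≠ 0` and every monomial of `P'` is a block-`i` sub-product
`∏_{j ∈ J} x_{i,j}` avoiding `x_{i,j₁}` with `|J| = d - (k+1)`, then `P'(Ax + b) ∘ G' ≠ 0` for every
`(k+1)`-independent (or more) `G'`: choose a monomial `J₀` ("Assume, WLOG, that for
`T = {2, …, k+1}`, `α_T ≠ 0`"), kill `T = [d] ∖ (J₀ ∪ {j₁})` — `k` shifts — after which only
`α_T ∏_{j ∈ J₀} ℓ_{i,j}` survives, a nonzero constant times a product of affine forms with nonzero
linear parts. [cite: MediniShpilka2021, proof of Lemma 6.2 (arXiv p0035:L36-L52)] -/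
theorem restrict_step (h : s * d ≤ n) {k : ℕ} (i : Fin s) (j₁ : Fin d)
    (P' : MvPolynomial (Fin (s * d)) K) (hP'0 : P' ≠ 0)
    (hP' : ∀ m ∈ P'.support, ∃ J : Finset (Fin d), j₁ ∉ J ∧ J.card + (k + 1) = d ∧
      m = ∑ j ∈ J, Finsupp.single (finProdFinEquiv (i, j)) (1 : ℕ))
    {A : Matrix (Fin n) (Fin n) K} (hA : IsUnit A.det) (b : Fin n → K)
    {B c : ℕ} (G' : Fin n → MvPolynomial (Fin B × (Fin c ⊕ Unit)) K) (hG' : IsIndependent B G')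
    (hB : k + 1 ≤ B) : bind₁ G' (affSubst h A b P') ≠ 0 := by
  classical
  -- a monomial `J₀` of `P'`
  obtain ⟨m₀, hm₀⟩ := Finset.nonempty_of_ne_empty (mt support_eq_empty.mp hP'0)
  obtain ⟨J₀, hj₁, hJ₀, rfl⟩ := hP' m₀ hm₀
  -- the killed set `T = [d] ∖ (J₀ ∪ {j₁})`, of cardinality `k`
  have hTcard : (Finset.univ \ insert j₁ J₀).card = k := by
    rw [Finset.card_sdiff_of_subset (Finset.subset_univ _), Finset.card_univ, Fintype.card_fin,
      Finset.card_insert_of_notMem hj₁]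
    omega
  refine shift_induction h i (Finset.univ \ insert j₁ J₀) P' ?_ A b hA B c G' hG' (by omega)
  intro A' b' hA' B' c' H hH hB'
  -- after the kills only the `J₀`-term survives
  have hkill : aeval (fun w => if w ∈ (Finset.univ \ insert j₁ J₀).image
      (fun j => finProdFinEquiv (i, j)) then (0 : MvPolynomial (Fin (s * d)) K) else X w) P' =
      monomial (∑ j ∈ J₀, Finsupp.single (finProdFinEquiv (i, j)) (1 : ℕ))
        (coeff (∑ j ∈ J₀, Finsupp.single (finProdFinEquiv (i, j)) (1 : ℕ)) P') := by
    conv_lhs => rw [P'.as_sum, map_sum]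
    rw [← Finset.sum_erase_add _ _ hm₀, aeval_kill_monomial_blockInd,
      if_pos (Finset.disjoint_left.mpr fun j hj hjT => (Finset.mem_sdiff.mp hjT).2
        (Finset.mem_insert_of_mem hj))]
    rw [Finset.sum_eq_zero, zero_add]
    intro m hm
    obtain ⟨hmne, hmsupp⟩ := Finset.mem_erase.mp hm
    obtain ⟨J, hj₁J, hJ, rfl⟩ := hP' m hmsupp
    rw [aeval_kill_monomial_blockInd, if_neg]
    intro hdisj
    -- `J` avoids `T` and `j₁`, so `J ⊆ J₀`; equal cardinalities force `J = J₀`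
    apply hmne
    have hsub : J ⊆ J₀ := by
      intro j hj
      have hjT : j ∉ Finset.univ \ insert j₁ J₀ := fun hjT => Finset.disjoint_left.mp hdisj hj hjT
      rw [Finset.mem_sdiff, not_and, not_not] at hjT
      rcases Finset.mem_insert.mp (hjT (Finset.mem_univ j)) with hjj | hjJ
      · exact absurd (hjj ▸ hj) hj₁J
      · exact hjJ
    rw [Finset.eq_of_subset_of_card_le hsub (by omega)]
  rw [hkill]
  exact bind₁_affSubst_monomial_blockInd_ne_zero h i J₀ (mem_support_iff.mp hm₀) hA' b' H hH hB'

end Shift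

/-! ### Lemma 6.2 "upstairs": block-structured polynomials composed with `(A, b)` and `G` -/

section Upstairs

variable {K : Type*} [Field K] {s d n : ℕ}

/-- **Lemma 6.2, upstairs form.** If `P ≠ 0` and every monomial of `P ∈ K[x_{1,1}, …, x_{s,d}]` is a
block sub-product `∏_{j ∈ J} x_{i,j}` with `|J| = d - k` (e.g. `P = ∂^k T_{s,d}/∂u_1⋯∂u_k`), then
`P(Ax + b) ∘ G ≠ 0` for every invertible affine `(A, b)` and every `B`-independent `G`, `B ≥ k + 2`.
Printed proof: constant `P` is trivial; otherwise some `∂P/∂x_{i,j₁} ≠ 0` ("`Q_i` depends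
non-trivially on `w_{i,1}`"), `∂f/∂u_{i,1} = (∂P/∂x_{i,j₁})(Ax + b)` for the dual `u_{i,1}`
(Lemma 3.8), the remaining `k + 1` blocks hit it (restriction step), and Lemma 3.9 concludes.
[cite: MediniShpilka2021, Lemma 6.2 and its proof (arXiv p0035:L19-L52)] -/
theorem bind₁_affSubst_ne_zero_of_blockSupport (h : s * d ≤ n) {k : ℕ}
    (P : MvPolynomial (Fin (s * d)) K) (hP0 : P ≠ 0)
    (hP : ∀ m ∈ P.support, ∃ (i : Fin s) (J : Finset (Fin d)), J.card + k = d ∧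
      m = ∑ j ∈ J, Finsupp.single (finProdFinEquiv (i, j)) (1 : ℕ))
    {A : Matrix (Fin n) (Fin n) K} (hA : IsUnit A.det) (b : Fin n → K)
    {B c : ℕ} (G : Fin n → MvPolynomial (Fin B × (Fin c ⊕ Unit)) K) (hG : IsIndependent B G)
    (hB : k + 2 ≤ B) : bind₁ G (affSubst h A b P) ≠ 0 := by
  classical
  by_cases hdeg : P.totalDegree = 0
  · -- constant `P`
    rw [totalDegree_eq_zero_iff_eq_C] at hdeg
    rw [hdeg, affSubst_C, bind₁_C_right, Ne, C_eq_zero]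
    intro h0
    apply hP0
    rw [hdeg, h0, C_0]
  -- a monomial of positive degree, `∏_{j ∈ J} x_{i,j}` with `j₁ ∈ J`
  obtain ⟨m, hm, hsup⟩ := Finset.exists_mem_eq_sup P.support
    (Finset.nonempty_of_ne_empty (mt support_eq_empty.mp hP0)) (fun m => m.sum fun _ e => e)
  have hm0 : m ≠ 0 := by
    intro hm0
    apply hdeg
    rw [totalDegree, hsup, hm0, Finsupp.sum_zero_index]
  obtain ⟨i, J, hJ, rfl⟩ := hP m hm
  obtain ⟨j₁, hj₁⟩ : J.Nonempty := by
    rw [Finset.nonempty_iff_ne_empty]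
    rintro rfl
    exact hm0 (by rw [Finset.sum_empty])
  -- `∂P/∂x_{i,j₁} ≠ 0`
  set w₁ := finProdFinEquiv (i, j₁) with hw₁
  have hP'0 : pderiv w₁ P ≠ 0 := by
    intro h0
    have hc := congr_arg (coeff (∑ j ∈ J.erase j₁, Finsupp.single (finProdFinEquiv (i, j)) (1 : ℕ))) h0
    rw [coeff_pderiv, coeff_zero, blockInd_erase_add_single i hj₁, hw₁, blockInd_apply] at hc
    rw [if_neg (fun h' => Finset.notMem_erase j₁ J h'.2)] at hc
    simp only [Nat.cast_zero, zero_add, mul_one] at hc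
    exact (mem_support_iff.mp hm) hc
  -- the monomials of `∂P/∂x_{i,j₁}`: block `i`, avoiding `j₁`, co-size `k + 1`
  have hP' : ∀ m' ∈ (pderiv w₁ P).support, ∃ J' : Finset (Fin d), j₁ ∉ J' ∧ J'.card + (k + 1) = d ∧
      m' = ∑ j ∈ J', Finsupp.single (finProdFinEquiv (i, j)) (1 : ℕ) := by
    intro m' hm'
    obtain ⟨i', J', j₀, hj₀, hw, hJ', -, rfl⟩ := blockSupport_pderiv hP w₁ m' hm'
    have hij := finProdFinEquiv.injective (hw₁.symm.trans hw)
    rw [Prod.mk.injEq] at hij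
    obtain ⟨rfl, rfl⟩ := hij
    exact ⟨J', hj₀, hJ', rfl⟩
  -- peel one block for Lemma 3.9; the other `k + 1` blocks do the restriction step
  obtain ⟨B', rfl⟩ : ∃ B', B = B' + 1 := ⟨B - 1, by omega⟩
  obtain ⟨G₁, G', hG₁, hG', hGeq⟩ := isIndependent_succ_iff.mp hG
  have hrest := restrict_step h i j₁ (pderiv w₁ P) hP'0 hP' hA b G' hG' (by omega)
  -- Lemma 3.8: the dual directional derivative of `P(Ax+b)` is `(∂P/∂x_{i,j₁})(Ax+b)`
  rw [← sum_C_mul_pderiv_affSubst h hA b P w₁] at hrest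
  have hGfun : G = fun j => rename (Prod.mk 0) (G₁ j) + rename (Prod.map Fin.succ id) (G' j) :=
    funext hGeq
  rw [hGfun]
  exact bind₁_peel_ne_zero_of_dirDeriv hG₁ G' (affSubst h A b P) _ hrest

end Upstairs

end DiagDeriv

/-! ### Directional derivatives of `g(Ax + b)` and the orbit-level statements -/

section Orbit

variable {K : Type*} [Field K] {m n s d : ℕ}

/-- `f^{GL_n(F)} ⊆ f^{GLaff_n(F)}` (take `b = 0`). [cite: MediniShpilka2021, §1.1.6 (CCC p.19:9; arXiv p0007:L16-L20)] -/
theorem linOrbit_subset_affOrbit (n : ℕ) (g : MvPolynomial (Fin m) K) :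
    linOrbit n g ⊆ affOrbit n g := by
  rintro f ⟨h, A, hA, rfl⟩
  exact ⟨h, A, 0, hA, rfl⟩

/-- **The chain rule for directional derivatives of `f = g(Ax + b)`** (Def 3.6):
`∂f/∂v = (∂g/∂u)(Ax + b)` with `u = A v` (restricted to the coordinates of `g`), i.e.
`Σ_j v_j ∂f/∂x_j = (Σ_w (Av)_w ∂g/∂y_w)(Ax + b)`.
[cite: MediniShpilka2021, Def 3.6 and Lemma 3.8 (arXiv p0017:L44-L62)] -/
theorem dirDeriv_affSubst (h : m ≤ n) (A : Matrix (Fin n) (Fin n) K) (b : Fin n → K)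
    (g : MvPolynomial (Fin m) K) (v : Fin n → K) :
    (∑ j, C (v j) * pderiv j (affSubst h A b g)) =
      affSubst h A b (∑ w, C ((A *ᵥ v) (Fin.castLE h w)) * pderiv w g) := by
  classical
  simp_rw [pderiv_affSubst h A b g, Finset.mul_sum]
  rw [Finset.sum_comm]
  unfold affSubst
  rw [map_sum]
  refine Finset.sum_congr rfl fun w _ => ?_
  rw [map_mul, aeval_C, algebraMap_eq, Matrix.mulVec, dotProduct, map_sum, Finset.sum_mul]
  refine Finset.sum_congr rfl fun j _ => ?_
  rw [map_mul]
  ring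

/-- Iterated: `∂^k f/∂v_1⋯∂v_k = (∂^k g/∂u_1⋯∂u_k)(Ax + b)` with `u_r = A v_r`.
[cite: MediniShpilka2021, Def 3.6, Lemma 3.8 and proof of Lemma 6.2 ("`Q_i(ℓ_{i,1}(x), …)`"; arXiv p0017:L44-L62, p0035:L24-L27)] -/
theorem iterate_dirDeriv_affSubst (h : m ≤ n) (A : Matrix (Fin n) (Fin n) K) (b : Fin n → K)
    (g : MvPolynomial (Fin m) K) {k : ℕ} (v : Fin k → Fin n → K) :
    (List.ofFn v).foldr (fun w p => ∑ j, C (w j) * pderiv j p) (affSubst h A b g) =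
      affSubst h A b ((List.ofFn fun l => fun w => (A *ᵥ v l) (Fin.castLE h w)).foldr
        (fun w p => ∑ j, C (w j) * pderiv j p) g) := by
  induction k with
  | zero => simp
  | succ k ih =>
      rw [List.ofFn_succ, List.foldr_cons, List.ofFn_succ, List.foldr_cons, ih (fun l => v l.succ),
        dirDeriv_affSubst]

/-- **Lemma 6.2 (general `k`).** For `f ∈ T_{s,d}^{GLaff_n(F)}`, directions `v_1, …, v_k ∈ F^n` and
every `B`-independent polynomial map `G` with `k + 2 ≤ B`:
`∂^k f/∂v_1⋯∂v_k ≠ 0 ⇒ (∂^k f/∂v_1⋯∂v_k) ∘ G ≠ 0`. [cite: MediniShpilka2021, Lemma 6.2 (arXiv p0035:L15-L17) and its proof (p0035:L19-L52)] -/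
theorem bind₁_iterate_dirDeriv_ne_zero_of_mem_affOrbit_sdm {k B c : ℕ}
    {f : MvPolynomial (Fin n) K} (hf : f ∈ affOrbit n (sdm K s d)) (v : Fin k → Fin n → K)
    (hne : (List.ofFn v).foldr (fun w p => ∑ j, C (w j) * pderiv j p) f ≠ 0)
    {G : Fin n → MvPolynomial (Fin B × (Fin c ⊕ Unit)) K} (hG : IsIndependent B G)
    (hB : k + 2 ≤ B) :
    bind₁ G ((List.ofFn v).foldr (fun w p => ∑ j, C (w j) * pderiv j p) f) ≠ 0 := by
  obtain ⟨h, A, b, hA, rfl⟩ := hf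
  rw [iterate_dirDeriv_affSubst] at hne ⊢
  refine DiagDeriv.bind₁_affSubst_ne_zero_of_blockSupport h _ ?_
    (DiagDeriv.blockSupport_iterate_dirDeriv_sdm k _) hA b G hG hB
  intro h0
  apply hne
  rw [h0]
  unfold affSubst
  rw [map_zero]

/-- **Corollary 6.3** (`k = 0`). "If `0 ≠ f ∈ T^{GLaff_n(F)}`, then for any `2`-independent map `G`:
`f ∘ G ≠ 0`" — here for every `B`-independent `G` with `2 ≤ B`.
[cite: MediniShpilka2021, Cor 6.3 (arXiv p0035:L54-L56)] -/
theorem bind₁_ne_zero_of_mem_affOrbit_sdm {B c : ℕ}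
    {f : MvPolynomial (Fin n) K} (hf : f ∈ affOrbit n (sdm K s d)) (hf0 : f ≠ 0)
    {G : Fin n → MvPolynomial (Fin B × (Fin c ⊕ Unit)) K} (hG : IsIndependent B G) (hB : 2 ≤ B) :
    bind₁ G f ≠ 0 := by
  have := bind₁_iterate_dirDeriv_ne_zero_of_mem_affOrbit_sdm (k := 0) hf
    (fun l => Fin.elim0 l) (by simpa using hf0) hG (by omega)
  simpa using this

/-- **Lemma 6.2, `k = 1`**: a nonzero first-order directional derivative `∂f/∂v` of
`f ∈ T_{s,d}^{GLaff_n(F)}` composed with any `B`-independent `G`, `3 ≤ B`, is nonzero.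
[cite: MediniShpilka2021, Lemma 6.2 with `k = 1` (arXiv p0035:L15-L17)] -/
theorem bind₁_dirDeriv_ne_zero_of_mem_affOrbit_sdm {B c : ℕ}
    {f : MvPolynomial (Fin n) K} (hf : f ∈ affOrbit n (sdm K s d)) (v : Fin n → K)
    (hne : (∑ j, C (v j) * pderiv j f) ≠ 0)
    {G : Fin n → MvPolynomial (Fin B × (Fin c ⊕ Unit)) K} (hG : IsIndependent B G) (hB : 3 ≤ B) :
    bind₁ G (∑ j, C (v j) * pderiv j f) ≠ 0 := by
  have := bind₁_iterate_dirDeriv_ne_zero_of_mem_affOrbit_sdm (k := 1) hf (fun _ => v)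
    (by simpa using hne) hG (by omega)
  simpa using this

/-- **Lemma 6.2, `k = 2`**: a nonzero second-order directional derivative `∂²f/∂u∂w` of
`f ∈ T_{s,d}^{GLaff_n(F)}` composed with any `B`-independent `G`, `4 ≤ B`, is nonzero.
[cite: MediniShpilka2021, Lemma 6.2 with `k = 2` (arXiv p0035:L15-L17); used in the proof of Thm 45 (p0036:L45-L47)] -/
theorem bind₁_dirDeriv_dirDeriv_ne_zero_of_mem_affOrbit_sdm {B c : ℕ}
    {f : MvPolynomial (Fin n) K} (hf : f ∈ affOrbit n (sdm K s d)) (u w : Fin n → K)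
    (hne : (∑ j, C (u j) * pderiv j (∑ j', C (w j') * pderiv j' f)) ≠ 0)
    {G : Fin n → MvPolynomial (Fin B × (Fin c ⊕ Unit)) K} (hG : IsIndependent B G) (hB : 4 ≤ B) :
    bind₁ G (∑ j, C (u j) * pderiv j (∑ j', C (w j') * pderiv j' f)) ≠ 0 := by
  have := bind₁_iterate_dirDeriv_ne_zero_of_mem_affOrbit_sdm (k := 2) hf ![u, w]
    (by simpa using hne) hG (by omega)
  simpa using this

end Orbit

end MS2021

end Literature.Computability.AlgebraicComplexity

end
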